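import Mathlib
import Summits.NavierStokesRegularity.NavierStokesRegularity.Theses.FilamentSkeletonRss
import Literature.Analysis.FluidPDE.PineauVicolRDSSLeray
import Literature.Analysis.FluidPDE.IsometryInvariance

/-!
# Route FilamentSkeletonRss · crux `CoreGluing` (stmt-NavierStokesRegularity-15401) — line `Sketch`, tool stub `stub_outwardTransportEnvelope`

Helper file (theorems only) supporting the crux item; lands with `--supports stmt-NavierStokesRegularity-15401`.

**Outward transport envelope** (mechanism of the idea card `volterra-ends`, full 3-D form; its
radial 1-D shadow is `stub_outgoingEnvelopeBound`). The first-order part of the rotated Leray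
profile operator is `L V(y) = α (J V(y) − DV(y)[J y]) + ½ V(y) + ½ DV(y)[y]`, `J = rotGen = e₃ × ·`.
Its characteristics are the spiral curves `Φ_σ y = e^{σ/2} R(−ασ) y` (`R = rotZ`) of the drift
`½ y − α J y`: `d/dσ Φ_σ y = ½ Φ_σ y − α J Φ_σ y` (`d/dθ R_θ x = J R_θ x`). Along a characteristic
the rotated, weighted value `Z(σ) = e^{σ/2} R(ασ) V(Φ_σ y)` satisfies `Z'(σ) = e^{σ/2} R(ασ) (L V)(Φ_σ y)`
(chain rule and `d/dτ R(ατ) w = α J R(ατ) w = α R(ατ) J w`), so by the fundamental theorem of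
calculus and `‖R_θ v‖ = ‖v‖`,

  `e^{s/2} ‖V(Φ_s y)‖ = ‖Z(s)‖ ≤ ‖Z(0)‖ + ∫₀ˢ ‖Z'‖ = ‖V y‖ + ∫₀ˢ e^{σ/2} ‖(L V)(Φ_σ y)‖ dσ`, `s ≥ 0`:

the Type-I envelope propagates outward along the characteristics with no condition at infinity.
Mathlib calculus (`HasDerivAt` chain/product rules, `intervalIntegral.integral_eq_sub_of_hasDerivAt`,
`intervalIntegral.norm_integral_le_integral_norm`) and the tree's `rotZ`/`rotGen` algebra
(`hasDerivAt_rotZ`, `norm_rotZ`, `rotZ_zero`, `rotGen_smul`, `rotZL`, `rotGenL`).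
-/

set_option linter.dupNamespace false

noncomputable section

namespace Summit.NavierStokesRegularity.NavierStokesRegularity.Theorems

open Set Function Filter MeasureTheory
open Literature.Analysis.FluidPDE Literature.Analysis.FluidPDE.PineauVicol2026
open scoped RealInnerProductSpace Laplacian ContDiff Topology

/-- The rotation about the axis in terms of the generator:
`R_θ v = v + sin θ • J v + (1 − cos θ) • J (J v)`. -/
private theorem outwardTransport_rotZ_decomp (θ : ℝ) (v : EuclideanSpace ℝ (Fin 3)) :
    rotZ θ v = v + Real.sin θ • rotGenL v + (1 - Real.cos θ) • rotGenL (rotGenL v) := by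
  ext i
  fin_cases i <;> simp [rotZ, rotGen] <;> ring

/-- The orbit `θ ↦ R_θ x` has velocity `J (R_θ x)` at every angle (`hasDerivAt_rotZ`, rewritten). -/
private theorem outwardTransport_hasDerivAt_rotZ (x : EuclideanSpace ℝ (Fin 3)) (θ₀ : ℝ) :
    HasDerivAt (fun θ => rotZ θ x) (rotGen (rotZ θ₀ x)) θ₀ := by
  have e : -Real.sin θ₀ • (WithLp.toLp 2 ![x 0, x 1, 0] : EuclideanSpace ℝ (Fin 3)) +
      Real.cos θ₀ • rotGen x = rotGen (rotZ θ₀ x) := by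
    ext i; fin_cases i <;> simp [rotGen] <;> ring
  rw [← e]
  exact hasDerivAt_rotZ x θ₀

/-- A moving vector rotated by a moving angle, `σ ↦ R_{θ(σ)} W(σ)`, is continuous when `θ` and `W`
are. -/
private theorem outwardTransport_continuous_rotZ {θ : ℝ → ℝ} {W : ℝ → EuclideanSpace ℝ (Fin 3)}
    (hθ : Continuous θ) (hW : Continuous W) : Continuous fun σ => rotZ (θ σ) (W σ) := by
  have e : (fun σ => rotZ (θ σ) (W σ)) = fun σ =>
      W σ + Real.sin (θ σ) • rotGenL (W σ) + (1 - Real.cos (θ σ)) • rotGenL (rotGenL (W σ)) :=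
    funext fun σ => outwardTransport_rotZ_decomp _ _
  rw [e]
  fun_prop

/-- **Derivative of a rotating moving vector**: if `W` has derivative `w'` at `σ`, then
`τ ↦ R(ατ) W(τ)` has derivative `R(ασ) (w' + α J W(σ))` at `σ`
(`d/dτ R(ατ) w = α J R(ατ) w = α R(ατ) J w`). -/
private theorem outwardTransport_hasDerivAt_rotZ_moving {W : ℝ → EuclideanSpace ℝ (Fin 3)}
    {w' : EuclideanSpace ℝ (Fin 3)} (α σ : ℝ) (hW : HasDerivAt W w' σ) :
    HasDerivAt (fun τ => rotZ (α * τ) (W τ)) (rotZ (α * σ) (w' + α • rotGen (W σ))) σ := by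
  have e : (fun τ => rotZ (α * τ) (W τ)) = fun τ =>
      W τ + Real.sin (α * τ) • rotGenL (W τ) +
        (1 - Real.cos (α * τ)) • rotGenL (rotGenL (W τ)) :=
    funext fun τ => outwardTransport_rotZ_decomp _ _
  rw [e]
  have hlin : HasDerivAt (fun τ : ℝ => α * τ) α σ := by
    simpa using (hasDerivAt_id σ).const_mul α
  have hsin : HasDerivAt (fun τ => Real.sin (α * τ)) (Real.cos (α * σ) * α) σ := hlin.sin
  have hcos : HasDerivAt (fun τ => 1 - Real.cos (α * τ)) (-(-Real.sin (α * σ) * α)) σ :=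
    hlin.cos.const_sub 1
  have hJ : HasDerivAt (fun τ => rotGenL (W τ)) (rotGenL w') σ := by
    have h := rotGenL.hasFDerivAt.comp_hasDerivAt σ hW
    simpa only [Function.comp_def] using h
  have hJJ : HasDerivAt (fun τ => rotGenL (rotGenL (W τ))) (rotGenL (rotGenL w')) σ := by
    have h := rotGenL.hasFDerivAt.comp_hasDerivAt σ hJ
    simpa only [Function.comp_def] using h
  have hsum := (hW.fun_add (hsin.fun_smul hJ)).fun_add (hcos.fun_smul hJJ)
  refine hsum.congr_deriv ?_
  ext i
  fin_cases i <;> simp [rotZ, rotGen] <;> ring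

/-- **The spiral characteristics.** The curve `Φ_τ y = e^{τ/2} R(−ατ) y` of the drift
`½ y − α J y` has velocity `½ Φ_σ y − α J (Φ_σ y)` at `τ = σ`. -/
private theorem outwardTransport_hasDerivAt_spiral (α : ℝ) (y : EuclideanSpace ℝ (Fin 3)) (σ : ℝ) :
    HasDerivAt (fun τ => Real.exp (τ / 2) • rotZ (-(α * τ)) y)
      ((1 / 2 : ℝ) • (Real.exp (σ / 2) • rotZ (-(α * σ)) y) -
        α • rotGen (Real.exp (σ / 2) • rotZ (-(α * σ)) y)) σ := by
  have hexp : HasDerivAt (fun τ => Real.exp (τ / 2)) (Real.exp (σ / 2) * (1 / 2)) σ :=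
    ((hasDerivAt_id σ).div_const 2).exp
  have hlin : HasDerivAt (fun τ : ℝ => -(α * τ)) (-α) σ := by
    simpa using ((hasDerivAt_id σ).const_mul α).fun_neg
  have hrot : HasDerivAt (fun τ => rotZ (-(α * τ)) y) ((-α) • rotGen (rotZ (-(α * σ)) y)) σ := by
    have h := (outwardTransport_hasDerivAt_rotZ y (-(α * σ))).scomp σ hlin
    simpa only [Function.comp_def] using h
  refine (hexp.smul hrot).congr_deriv ?_
  rw [rotGen_smul]
  module

/-- **Transport identity along a characteristic.** Let `V ∈ C¹(ℝ³; ℝ³)` and let `Φ : ℝ → ℝ³` be a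
curve with `Φ' = ½ Φ − α J Φ`. Then `Z(σ) = e^{σ/2} R(ασ) V(Φ σ)` has the continuous derivative
`Z'(σ) = e^{σ/2} R(ασ) [α (J V − DV[J Φ σ]) + ½ V + ½ DV[Φ σ]](Φ σ)`, whence by the fundamental
theorem of calculus and `‖R_θ v‖ = ‖v‖`, for `s ≥ 0`,
`e^{s/2} ‖V(Φ s)‖ ≤ ‖V(Φ 0)‖ + ∫₀ˢ e^{σ/2} ‖α (J V − DV[J Φ σ]) + ½ V + ½ DV[Φ σ]‖(Φ σ) dσ`. -/
private theorem outwardTransport_along {V : EuclideanSpace ℝ (Fin 3) → EuclideanSpace ℝ (Fin 3)}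
    (hV : ContDiff ℝ 1 V) (α : ℝ) {Φ : ℝ → EuclideanSpace ℝ (Fin 3)}
    (hΦ : ∀ σ, HasDerivAt Φ ((1 / 2 : ℝ) • Φ σ - α • rotGen (Φ σ)) σ) {s : ℝ} (hs : 0 ≤ s) :
    Real.exp (s / 2) * ‖V (Φ s)‖ ≤ ‖V (Φ 0)‖ +
      ∫ σ in (0 : ℝ)..s, Real.exp (σ / 2) *
        ‖α • (rotGen (V (Φ σ)) - fderiv ℝ V (Φ σ) (rotGen (Φ σ))) +
          (1 / 2 : ℝ) • V (Φ σ) + (1 / 2 : ℝ) • fderiv ℝ V (Φ σ) (Φ σ)‖ := by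
  have hVd : Differentiable ℝ V := hV.differentiable one_ne_zero
  have hΦc : Continuous Φ := continuous_iff_continuousAt.2 fun σ => (hΦ σ).continuousAt
  -- the first-order operator applied to `V`, evaluated along the characteristic
  set G : ℝ → EuclideanSpace ℝ (Fin 3) := fun σ =>
    α • (rotGen (V (Φ σ)) - fderiv ℝ V (Φ σ) (rotGen (Φ σ))) +
      (1 / 2 : ℝ) • V (Φ σ) + (1 / 2 : ℝ) • fderiv ℝ V (Φ σ) (Φ σ) with hG
  -- `W = V ∘ Φ` and the rotating vector `R(α·) W`
  have hW : ∀ σ, HasDerivAt (fun τ => V (Φ τ))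
      (fderiv ℝ V (Φ σ) ((1 / 2 : ℝ) • Φ σ - α • rotGen (Φ σ))) σ := fun σ => by
    have h := (hVd (Φ σ)).hasFDerivAt.comp_hasDerivAt σ (hΦ σ)
    simpa only [Function.comp_def] using h
  have hR : ∀ σ, HasDerivAt (fun τ => rotZ (α * τ) (V (Φ τ)))
      (rotZ (α * σ) (fderiv ℝ V (Φ σ) ((1 / 2 : ℝ) • Φ σ - α • rotGen (Φ σ)) +
        α • rotGen (V (Φ σ)))) σ := fun σ =>
    outwardTransport_hasDerivAt_rotZ_moving α σ (hW σ)
  have hexp : ∀ σ : ℝ, HasDerivAt (fun τ : ℝ => Real.exp (τ / 2)) (Real.exp (σ / 2) * (1 / 2)) σ :=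
    fun σ => ((hasDerivAt_id σ).div_const 2).exp
  -- `Z = e^{σ/2} R(ασ) W` has derivative `e^{σ/2} R(ασ) G`
  have hZ : ∀ σ, HasDerivAt (fun τ => Real.exp (τ / 2) • rotZ (α * τ) (V (Φ τ)))
      (Real.exp (σ / 2) • rotZ (α * σ) (G σ)) σ := fun σ => by
    refine ((hexp σ).smul (hR σ)).congr_deriv ?_
    simp only [hG, ← rotZL_apply, map_add, map_sub, map_smul]
    module
  -- the derivative is continuous (`V ∈ C¹`)
  have hGc : Continuous G := by
    have hD : Continuous fun σ => fderiv ℝ V (Φ σ) :=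
      (hV.continuous_fderiv one_ne_zero).comp hΦc
    have h1 : Continuous fun σ => fderiv ℝ V (Φ σ) (rotGen (Φ σ)) :=
      hD.clm_apply (rotGenL.continuous.comp hΦc)
    have h2 : Continuous fun σ => fderiv ℝ V (Φ σ) (Φ σ) := hD.clm_apply hΦc
    have h3 : Continuous fun σ => V (Φ σ) := hV.continuous.comp hΦc
    have h4 : Continuous fun σ => rotGen (V (Φ σ)) := rotGenL.continuous.comp h3
    exact (((h4.sub h1).const_smul α).add (h3.const_smul (1 / 2 : ℝ))).add
      (h2.const_smul (1 / 2 : ℝ))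
  have hZ'c : Continuous fun σ => Real.exp (σ / 2) • rotZ (α * σ) (G σ) :=
    (Real.continuous_exp.comp (continuous_id.div_const 2)).smul
      (outwardTransport_continuous_rotZ (continuous_const.mul continuous_id) hGc)
  -- fundamental theorem of calculus on `[0, s]`
  have hftc : ∫ σ in (0 : ℝ)..s, Real.exp (σ / 2) • rotZ (α * σ) (G σ) =
      Real.exp (s / 2) • rotZ (α * s) (V (Φ s)) - Real.exp (0 / 2) • rotZ (α * 0) (V (Φ 0)) :=
    intervalIntegral.integral_eq_sub_of_hasDerivAt (fun σ _ => hZ σ) (hZ'c.intervalIntegrable 0 s)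
  have h0 : Real.exp (0 / 2) • rotZ (α * 0) (V (Φ 0)) = V (Φ 0) := by
    rw [zero_div, Real.exp_zero, one_smul, mul_zero, rotZ_zero]
  have hnorm : ∀ σ, ‖Real.exp (σ / 2) • rotZ (α * σ) (G σ)‖ = Real.exp (σ / 2) * ‖G σ‖ :=
    fun σ => by rw [norm_smul, Real.norm_of_nonneg (Real.exp_pos _).le, norm_rotZ]
  calc Real.exp (s / 2) * ‖V (Φ s)‖ = ‖Real.exp (s / 2) • rotZ (α * s) (V (Φ s))‖ := by
        rw [norm_smul, Real.norm_of_nonneg (Real.exp_pos _).le, norm_rotZ]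
    _ = ‖V (Φ 0) + ∫ σ in (0 : ℝ)..s, Real.exp (σ / 2) • rotZ (α * σ) (G σ)‖ := by
        rw [hftc, h0, add_sub_cancel]
    _ ≤ ‖V (Φ 0)‖ + ‖∫ σ in (0 : ℝ)..s, Real.exp (σ / 2) • rotZ (α * σ) (G σ)‖ := norm_add_le _ _
    _ ≤ ‖V (Φ 0)‖ + ∫ σ in (0 : ℝ)..s, ‖Real.exp (σ / 2) • rotZ (α * σ) (G σ)‖ := by
        gcongr
        exact intervalIntegral.norm_integral_le_integral_norm hs
    _ = ‖V (Φ 0)‖ + ∫ σ in (0 : ℝ)..s, Real.exp (σ / 2) * ‖G σ‖ := by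
        simp_rw [hnorm]

/-- **Registered stub `stub_outwardTransportEnvelope`** (line `Sketch` of the crux `CoreGluing`,
stmt-NavierStokesRegularity-15401; mechanism of the card `volterra-ends`). Outward transport
identity along the spiral characteristics `Φ_s y = e^{s/2} R(−αs) y` of the drift `½y − α e₃×y`:
for `V ∈ C¹` and `s ≥ 0`, the weighted value `e^{s/2}‖V(Φ_s y)‖` is at most `‖V y‖` plus the
integral along the characteristic of `e^{σ/2}` times the norm of the linear first-order part
`α(JV − DV[J·]) + ½V + ½DV[·]` of the rotated Leray profile operator applied to `V` — the Type-I
envelope propagates outward with no condition at infinity. -/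
theorem stub_outwardTransportEnvelope : ∀ (α : ℝ) (V : EuclideanSpace ℝ (Fin 3) → EuclideanSpace ℝ (Fin 3)), ContDiff ℝ 1 V → ∀ (y : EuclideanSpace ℝ (Fin 3)) (s : ℝ), 0 ≤ s → Real.exp (s / 2) * ‖V (Real.exp (s / 2) • rotZ (-(α * s)) y)‖ ≤ ‖V y‖ + ∫ σ in (0 : ℝ)..s, Real.exp (σ / 2) * ‖α • (rotGen (V (Real.exp (σ / 2) • rotZ (-(α * σ)) y)) - fderiv ℝ V (Real.exp (σ / 2) • rotZ (-(α * σ)) y) (rotGen (Real.exp (σ / 2) • rotZ (-(α * σ)) y))) + (1 / 2 : ℝ) • V (Real.exp (σ / 2) • rotZ (-(α * σ)) y) + (1 / 2 : ℝ) • fderiv ℝ V (Real.exp (σ / 2) • rotZ (-(α * σ)) y) (Real.exp (σ / 2) • rotZ (-(α * σ)) y)‖ := by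
  intro α V hV y s hs
  have key := outwardTransport_along hV α (Φ := fun σ => Real.exp (σ / 2) • rotZ (-(α * σ)) y)
    (outwardTransport_hasDerivAt_spiral α y) hs
  have h0 : Real.exp (0 / 2) • rotZ (-(α * 0)) y = y := by
    rw [zero_div, Real.exp_zero, one_smul, mul_zero, neg_zero, rotZ_zero]
  simp only [h0] at key
  exact key

end Summit.NavierStokesRegularity.NavierStokesRegularity.Theorems
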